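import Mathlib.Analysis.Complex.Basic
import Mathlib.Analysis.SpecificLimits.Basic
import Mathlib.Analysis.Normed.Group.InfiniteSum
import Mathlib.Data.Matrix.Basic
import Mathlib.Data.Matrix.Mul
import HarnessLib

/-!
# Infinite matrices on `ℕ`: corner-dominated kernels, products and finite sections

Topic `Analysis/Toeplitz`, namespace `Literature.Analysis.Toeplitz`. First file of an elementary
("von Koch") theory of infinite determinants `det (1 + K)` for kernels `K : ℕ × ℕ → ℂ` that are
**corner-dominated**, `|K i j| ≤ C ρ^{i+j}` with `0 < ρ < 1` — the class in which the Hankel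
products `H(b₊)H(b̃₋)` of a symbol with geometrically decaying Fourier coefficients live. This is the
operator-theoretic substrate of the Basor–Helton / Widom proof of the strong Szegő limit theorem
(Deift–Its–Krasovsky 2013, §3: `D_n(φ) = ((φ₊)₀(φ₋)₀)ⁿ det (P_n {T(φ₊)⁻¹, T(φ₋)} P_n)` and the
multiplicative commutator is `1 + (trace class)`), carried out in the sibling files
`KochDeterminant`, `ToeplitzHankel`, `StrongSzegoGeometric` without any Hilbert-space operator
theory: everything is absolutely convergent sums.

## Contents (all proved; no named facts)

* `finSection n A` — the `n × n` upper-left corner of `A : Matrix ℕ ℕ ℂ` (`P_n A P_n`);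
* `imul A B` — the matrix product `(A B) i j = ∑' m, A i m * B m j` (a `tsum`; meaningful under the
  summability hypotheses below), and its truncations `imulTrunc N A B` (`A P_N B`, a finite sum) with
  `finSection_imulTrunc : finSection n (imulTrunc n A B) = finSection n A * finSection n B` and
  `tendsto_imulTrunc`;
* `IsCorner ρ C K : ∀ i j, ‖K i j‖ ≤ C ρ^{i+j}` and its closure properties (`add`, `sub`, `smul`,
  `imul`, `imulTrunc`);
* the one-sided classes `IsRowDom ρ α A` (`∑_m ‖A i m‖ ρ^m ≤ α ρ^i`) and `IsColDom ρ α A`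
  (`∑_m ρ^m ‖A m j‖ ≤ α ρ^j`), which act on corner kernels: `IsRowDom.imul_corner`,
  `IsCorner.imul_colDom` (these are the hypotheses of Sylvester's identity `det(1+AK) = det(1+KA)`
  in `KochDeterminant`).

## References

* H. von Koch, *Sur les déterminants infinis et les équations différentielles linéaires*, Acta
  Math. 16 (1892) 217–295 (absolutely convergent infinite determinants).
* P. Deift, A. Its, I. Krasovsky, Comm. Pure Appl. Math. 66 (2013) 1360–1438, §3.
-/

noncomputable section

open Finset Filter
open scoped _root_.Topology BigOperators

namespace Literature.Analysis.Toeplitz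

/-! ### Finite sections -/

/-- The `n × n` **finite section** `P_n A P_n` of an infinite matrix, as a `Fin n`-indexed matrix. [folklore] -/
def finSection (n : ℕ) (A : Matrix ℕ ℕ ℂ) : Matrix (Fin n) (Fin n) ℂ :=
  A.submatrix Fin.val Fin.val

/-- Entries of the finite section. [folklore] -/
@[simp] theorem finSection_apply (n : ℕ) (A : Matrix ℕ ℕ ℂ) (i j : Fin n) :
    finSection n A i j = A i j := rfl

/-- Finite sections are additive. [folklore] -/
@[simp] theorem finSection_add (n : ℕ) (A B : Matrix ℕ ℕ ℂ) :
    finSection n (A + B) = finSection n A + finSection n B := rfl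

/-- Finite sections commute with subtraction. [folklore] -/
@[simp] theorem finSection_sub (n : ℕ) (A B : Matrix ℕ ℕ ℂ) :
    finSection n (A - B) = finSection n A - finSection n B := rfl

/-- Finite sections are homogeneous. [folklore] -/
@[simp] theorem finSection_smul (n : ℕ) (c : ℂ) (A : Matrix ℕ ℕ ℂ) :
    finSection n (c • A) = c • finSection n A := rfl

/-- The finite section of the identity is the identity. [folklore] -/
@[simp] theorem finSection_one (n : ℕ) : finSection n (1 : Matrix ℕ ℕ ℂ) = 1 := by
  ext i j
  simp only [finSection_apply, Matrix.one_apply, Fin.val_eq_val]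

/-- The finite section of zero is zero. [folklore] -/
@[simp] theorem finSection_zero (n : ℕ) : finSection n (0 : Matrix ℕ ℕ ℂ) = 0 := rfl

/-! ### Products -/

/-- The **product of two infinite matrices**, `(A B) i j = ∑' m, A i m * B m j` (a topological sum;
under the domination hypotheses used in this theory the sum is absolutely convergent). [folklore] -/
def imul (A B : Matrix ℕ ℕ ℂ) : Matrix ℕ ℕ ℂ := fun i j => ∑' m, A i m * B m j

/-- Unfolding of `imul`. [folklore] -/
theorem imul_apply (A B : Matrix ℕ ℕ ℂ) (i j : ℕ) : imul A B i j = ∑' m, A i m * B m j := rfl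

/-- The **truncated product** `A P_N B`, `(A P_N B) i j = ∑_{m < N} A i m * B m j`. [folklore] -/
def imulTrunc (N : ℕ) (A B : Matrix ℕ ℕ ℂ) : Matrix ℕ ℕ ℂ :=
  fun i j => ∑ m ∈ range N, A i m * B m j

/-- Unfolding of `imulTrunc`. [folklore] -/
theorem imulTrunc_apply (N : ℕ) (A B : Matrix ℕ ℕ ℂ) (i j : ℕ) :
    imulTrunc N A B i j = ∑ m ∈ range N, A i m * B m j := rfl

/-- **`P_n (A P_n B) P_n = (P_n A P_n)(P_n B P_n)`**: the `n`-section of the product truncated at `n`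
is the product of the `n`-sections. [folklore] -/
theorem finSection_imulTrunc (n : ℕ) (A B : Matrix ℕ ℕ ℂ) :
    finSection n (imulTrunc n A B) = finSection n A * finSection n B := by
  ext i j
  simp only [finSection_apply, imulTrunc_apply, Matrix.mul_apply]
  exact (Fin.sum_univ_eq_sum_range (fun m => A i m * B m j) n).symm

/-- The truncated products converge to the product, entrywise, when the defining series is summable. [folklore] -/
theorem tendsto_imulTrunc {A B : Matrix ℕ ℕ ℂ} {i j : ℕ} (h : Summable fun m => A i m * B m j) :
    Tendsto (fun N => imulTrunc N A B i j) atTop (𝓝 (imul A B i j)) :=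
  h.hasSum.tendsto_sum_nat

/-- Left distributivity of the product over addition (under summability). [folklore] -/
theorem imul_add {A B B' : Matrix ℕ ℕ ℂ} (h : ∀ i j, Summable fun m => A i m * B m j)
    (h' : ∀ i j, Summable fun m => A i m * B' m j) :
    imul A (B + B') = imul A B + imul A B' := by
  ext i j
  simp only [imul_apply, Matrix.add_apply, mul_add]
  exact (h i j).tsum_add (h' i j)

/-- Right distributivity of the product over addition (under summability). [folklore] -/
theorem add_imul {A A' B : Matrix ℕ ℕ ℂ} (h : ∀ i j, Summable fun m => A i m * B m j)
    (h' : ∀ i j, Summable fun m => A' i m * B m j) :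
    imul (A + A') B = imul A B + imul A' B := by
  ext i j
  simp only [imul_apply, Matrix.add_apply, add_mul]
  exact (h i j).tsum_add (h' i j)

/-- The product with the identity on the right. [folklore] -/
@[simp] theorem imul_one (A : Matrix ℕ ℕ ℂ) : imul A 1 = A := by
  ext i j
  rw [imul_apply, tsum_eq_single j]
  · simp
  · intro m hm
    simp [hm]

/-- The product with the identity on the left. [folklore] -/
@[simp] theorem one_imul (A : Matrix ℕ ℕ ℂ) : imul 1 A = A := by
  ext i j
  rw [imul_apply, tsum_eq_single i]
  · simp
  · intro m hm
    simp [Ne.symm hm]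

/-- The product with zero on the right. [folklore] -/
@[simp] theorem imul_zero (A : Matrix ℕ ℕ ℂ) : imul A 0 = 0 := by
  ext i j; simp [imul_apply]

/-- The product with zero on the left. [folklore] -/
@[simp] theorem zero_imul (A : Matrix ℕ ℕ ℂ) : imul 0 A = 0 := by
  ext i j; simp [imul_apply]

/-- Scalars pull out of the product on the left. [folklore] -/
theorem smul_imul (c : ℂ) (A B : Matrix ℕ ℕ ℂ) : imul (c • A) B = c • imul A B := by
  ext i j
  simp only [imul_apply, Matrix.smul_apply, smul_eq_mul, mul_assoc]
  exact tsum_mul_left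

/-- Scalars pull out of the product on the right. [folklore] -/
theorem imul_smul (c : ℂ) (A B : Matrix ℕ ℕ ℂ) : imul A (c • B) = c • imul A B := by
  ext i j
  simp only [imul_apply, Matrix.smul_apply, smul_eq_mul]
  rw [← tsum_mul_left]
  exact tsum_congr fun m => by ring

/-- Negation pulls out of the product on the right. [folklore] -/
theorem imul_neg (A B : Matrix ℕ ℕ ℂ) : imul A (-B) = -imul A B := by
  ext i j
  simp only [imul_apply, Matrix.neg_apply, mul_neg]
  exact tsum_neg

/-- Negation pulls out of the product on the left. [folklore] -/
theorem neg_imul (A B : Matrix ℕ ℕ ℂ) : imul (-A) B = -imul A B := by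
  ext i j
  simp only [imul_apply, Matrix.neg_apply, neg_mul]
  exact tsum_neg

/-! ### Corner-dominated kernels -/

/-- **Corner domination**: `|K i j| ≤ C ρ^{i+j}` for all `i, j` — the decay of the Hankel products
`H(a)H(b̃)` of symbols with geometrically decaying coefficients; for `0 < ρ < 1` such kernels are
"super trace class" (`KochDeterminant`). [folklore] -/
def IsCorner (ρ C : ℝ) (K : Matrix ℕ ℕ ℂ) : Prop :=
  ∀ i j : ℕ, ‖K i j‖ ≤ C * ρ ^ (i + j)

namespace IsCorner

variable {ρ C D : ℝ} {K L : Matrix ℕ ℕ ℂ}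

/-- The constant of a corner bound is nonnegative (look at the `(0,0)` entry). [folklore] -/
theorem nonneg (h : IsCorner ρ C K) : 0 ≤ C := by
  have := h 0 0
  simp only [add_zero, pow_zero, mul_one] at this
  exact (norm_nonneg _).trans this

/-- Weakening the constant. [folklore] -/
theorem mono (h : IsCorner ρ C K) (hρ : 0 ≤ ρ) (hCD : C ≤ D) : IsCorner ρ D K :=
  fun i j => (h i j).trans (mul_le_mul_of_nonneg_right hCD (pow_nonneg hρ _))

/-- The zero kernel. [folklore] -/
theorem zero (ρ : ℝ) : IsCorner ρ 0 (0 : Matrix ℕ ℕ ℂ) := fun i j => by simp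

/-- Sums of corner kernels. [folklore] -/
theorem add (hK : IsCorner ρ C K) (hL : IsCorner ρ D L) : IsCorner ρ (C + D) (K + L) := fun i j =>
  calc ‖(K + L) i j‖ ≤ ‖K i j‖ + ‖L i j‖ := norm_add_le _ _
    _ ≤ C * ρ ^ (i + j) + D * ρ ^ (i + j) := add_le_add (hK i j) (hL i j)
    _ = (C + D) * ρ ^ (i + j) := by ring

/-- Negation. [folklore] -/
theorem neg (hK : IsCorner ρ C K) : IsCorner ρ C (-K) := fun i j => by
  rw [Matrix.neg_apply, norm_neg]; exact hK i j

/-- Differences of corner kernels. [folklore] -/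
theorem sub (hK : IsCorner ρ C K) (hL : IsCorner ρ D L) : IsCorner ρ (C + D) (K - L) := by
  rw [sub_eq_add_neg]; exact hK.add hL.neg

/-- Scalar multiples. [folklore] -/
theorem smul (hK : IsCorner ρ C K) (c : ℂ) : IsCorner ρ (‖c‖ * C) (c • K) := fun i j => by
  rw [Matrix.smul_apply, smul_eq_mul, norm_mul, mul_assoc]
  exact mul_le_mul_of_nonneg_left (hK i j) (norm_nonneg c)

/-- The entries of a product of corner kernels are dominated by a geometric series. [folklore] -/
theorem norm_mul_le (hK : IsCorner ρ C K) (hL : IsCorner ρ D L) (hρ : 0 ≤ ρ) (i j m : ℕ) :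
    ‖K i m * L m j‖ ≤ C * D * ρ ^ (i + j) * (ρ ^ 2) ^ m := by
  rw [norm_mul]
  calc ‖K i m‖ * ‖L m j‖ ≤ C * ρ ^ (i + m) * (D * ρ ^ (m + j)) :=
        mul_le_mul (hK i m) (hL m j) (norm_nonneg _) (mul_nonneg hK.nonneg (pow_nonneg hρ _))
    _ = C * D * ρ ^ (i + j) * (ρ ^ 2) ^ m := by ring

/-- The defining series of a product of corner kernels is absolutely summable (`0 ≤ ρ < 1`). [folklore] -/
theorem summable_norm_mul (hK : IsCorner ρ C K) (hL : IsCorner ρ D L) (hρ : 0 ≤ ρ) (hρ1 : ρ < 1)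
    (i j : ℕ) : Summable fun m => ‖K i m * L m j‖ := by
  have hρ2 : ρ ^ 2 < 1 := pow_lt_one₀ hρ hρ1 two_ne_zero
  refine Summable.of_nonneg_of_le (fun m => norm_nonneg _) (fun m => hK.norm_mul_le hL hρ i j m) ?_
  exact (summable_geometric_of_lt_one (pow_nonneg hρ 2) hρ2).mul_left _

/-- The defining series of a product of corner kernels is summable (`0 ≤ ρ < 1`). [folklore] -/
theorem summable_mul (hK : IsCorner ρ C K) (hL : IsCorner ρ D L) (hρ : 0 ≤ ρ) (hρ1 : ρ < 1)
    (i j : ℕ) : Summable fun m => K i m * L m j :=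
  (hK.summable_norm_mul hL hρ hρ1 i j).of_norm

/-- **Products of corner kernels are corner kernels**: constant `C D / (1 - ρ²)`. [folklore] -/
theorem imul (hK : IsCorner ρ C K) (hL : IsCorner ρ D L) (hρ : 0 ≤ ρ) (hρ1 : ρ < 1) :
    IsCorner ρ (C * D / (1 - ρ ^ 2)) (imul K L) := by
  intro i j
  have hρ2 : ρ ^ 2 < 1 := pow_lt_one₀ hρ hρ1 two_ne_zero
  have hgeo := summable_geometric_of_lt_one (pow_nonneg hρ 2) hρ2
  rw [imul_apply]
  calc ‖∑' m, K i m * L m j‖ ≤ ∑' m, ‖K i m * L m j‖ := norm_tsum_le_tsum_norm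
        (hK.summable_norm_mul hL hρ hρ1 i j)
    _ ≤ ∑' m, C * D * ρ ^ (i + j) * (ρ ^ 2) ^ m :=
        (hK.summable_norm_mul hL hρ hρ1 i j).tsum_le_tsum (fun m => hK.norm_mul_le hL hρ i j m)
          (hgeo.mul_left _)
    _ = C * D * ρ ^ (i + j) * (1 - ρ ^ 2)⁻¹ := by rw [tsum_mul_left, tsum_geometric_of_lt_one
        (pow_nonneg hρ 2) hρ2]
    _ = C * D / (1 - ρ ^ 2) * ρ ^ (i + j) := by ring

/-- Truncated products of corner kernels are corner kernels, with the same constant, uniformly in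
the truncation. [folklore] -/
theorem imulTrunc (hK : IsCorner ρ C K) (hL : IsCorner ρ D L) (hρ : 0 ≤ ρ) (hρ1 : ρ < 1) (N : ℕ) :
    IsCorner ρ (C * D / (1 - ρ ^ 2)) (imulTrunc N K L) := by
  intro i j
  have hρ2 : ρ ^ 2 < 1 := pow_lt_one₀ hρ hρ1 two_ne_zero
  have hgeo := summable_geometric_of_lt_one (pow_nonneg hρ 2) hρ2
  rw [imulTrunc_apply]
  calc ‖∑ m ∈ range N, K i m * L m j‖ ≤ ∑ m ∈ range N, ‖K i m * L m j‖ := norm_sum_le _ _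
    _ ≤ ∑ m ∈ range N, C * D * ρ ^ (i + j) * (ρ ^ 2) ^ m :=
        sum_le_sum fun m _ => hK.norm_mul_le hL hρ i j m
    _ ≤ ∑' m, C * D * ρ ^ (i + j) * (ρ ^ 2) ^ m :=
        (hgeo.mul_left _).sum_le_tsum _ (fun m _ => mul_nonneg (mul_nonneg
          (mul_nonneg hK.nonneg hL.nonneg) (pow_nonneg hρ _)) (pow_nonneg (pow_nonneg hρ 2) _))
    _ = C * D * ρ ^ (i + j) * (1 - ρ ^ 2)⁻¹ := by rw [tsum_mul_left, tsum_geometric_of_lt_one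
        (pow_nonneg hρ 2) hρ2]
    _ = C * D / (1 - ρ ^ 2) * ρ ^ (i + j) := by ring

/-- The truncated products of corner kernels converge entrywise to the product. [folklore] -/
theorem tendsto_imulTrunc (hK : IsCorner ρ C K) (hL : IsCorner ρ D L) (hρ : 0 ≤ ρ) (hρ1 : ρ < 1)
    (i j : ℕ) : Tendsto (fun N => Toeplitz.imulTrunc N K L i j) atTop (𝓝 (Toeplitz.imul K L i j)) :=
  Toeplitz.tendsto_imulTrunc (hK.summable_mul hL hρ hρ1 i j)

/-- The diagonal of a corner kernel is absolutely summable. [folklore] -/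
theorem summable_norm_diag (hK : IsCorner ρ C K) (hρ : 0 ≤ ρ) (hρ1 : ρ < 1) :
    Summable fun i => ‖K i i‖ := by
  have hρ2 : ρ ^ 2 < 1 := pow_lt_one₀ hρ hρ1 two_ne_zero
  refine Summable.of_nonneg_of_le (fun i => norm_nonneg _) (fun i => ?_)
    ((summable_geometric_of_lt_one (pow_nonneg hρ 2) hρ2).mul_left C)
  calc ‖K i i‖ ≤ C * ρ ^ (i + i) := hK i i
    _ = C * (ρ ^ 2) ^ i := by rw [← two_mul, pow_mul]

/-- Entries of a corner kernel are bounded by the constant (`0 ≤ ρ ≤ 1`). [folklore] -/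
theorem norm_le (hK : IsCorner ρ C K) (hρ : 0 ≤ ρ) (hρ1 : ρ ≤ 1) (i j : ℕ) : ‖K i j‖ ≤ C :=
  (hK i j).trans (mul_le_of_le_one_right hK.nonneg (pow_le_one₀ hρ hρ1))

end IsCorner

/-! ### One-sided domination: the operators acting on corner kernels -/

/-- **Row domination**: the weighted row sums `∑_m ‖A i m‖ ρ^m` are at most `α ρ^i`. Together with
`IsColDom` this is the part of "bounded operator" used by Sylvester's identity; Toeplitz matrices
with symbol in the weighted Wiener algebra `∑ |c_k| ρ^{-|k|} < ∞` and corner kernels both satisfy it. [folklore] -/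
def IsRowDom (ρ α : ℝ) (A : Matrix ℕ ℕ ℂ) : Prop :=
  ∀ i : ℕ, Summable (fun m => ‖A i m‖ * ρ ^ m) ∧ ∑' m, ‖A i m‖ * ρ ^ m ≤ α * ρ ^ i

/-- **Column domination**: the weighted column sums `∑_m ρ^m ‖A m j‖` are at most `α ρ^j`. [folklore] -/
def IsColDom (ρ α : ℝ) (A : Matrix ℕ ℕ ℂ) : Prop :=
  ∀ j : ℕ, Summable (fun m => ρ ^ m * ‖A m j‖) ∧ ∑' m, ρ ^ m * ‖A m j‖ ≤ α * ρ ^ j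

/-- The constant of a row bound is nonnegative when `0 ≤ ρ`. [folklore] -/
theorem IsRowDom.nonneg' {ρ α : ℝ} {A : Matrix ℕ ℕ ℂ} (hA : IsRowDom ρ α A) (hρ : 0 ≤ ρ) : 0 ≤ α := by
  have h := (hA 0).2
  simp only [pow_zero, mul_one] at h
  exact (tsum_nonneg fun m => mul_nonneg (norm_nonneg _) (pow_nonneg hρ _)).trans h

/-- The constant of a column bound is nonnegative when `0 ≤ ρ`. [folklore] -/
theorem IsColDom.nonneg' {ρ α : ℝ} {A : Matrix ℕ ℕ ℂ} (hA : IsColDom ρ α A) (hρ : 0 ≤ ρ) : 0 ≤ α := by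
  have h := (hA 0).2
  simp only [pow_zero, mul_one] at h
  exact (tsum_nonneg fun m => mul_nonneg (pow_nonneg hρ _) (norm_nonneg _)).trans h

/-- A row-dominated matrix times a corner kernel: the defining series is absolutely summable. [folklore] -/
theorem IsRowDom.summable_norm_mul_corner {ρ α C : ℝ} {A K : Matrix ℕ ℕ ℂ} (hA : IsRowDom ρ α A)
    (hK : IsCorner ρ C K) (i j : ℕ) : Summable fun m => ‖A i m * K m j‖ := by
  refine Summable.of_nonneg_of_le (fun m => norm_nonneg _) (fun m => ?_)
    (((hA i).1.mul_left (C * ρ ^ j)))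
  rw [norm_mul]
  calc ‖A i m‖ * ‖K m j‖ ≤ ‖A i m‖ * (C * ρ ^ (m + j)) :=
        mul_le_mul_of_nonneg_left (hK m j) (norm_nonneg _)
    _ = C * ρ ^ j * (‖A i m‖ * ρ ^ m) := by ring

/-- **A row-dominated matrix times a corner kernel is a corner kernel**, constant `α C`. [folklore] -/
theorem IsRowDom.imul_corner {ρ α C : ℝ} {A K : Matrix ℕ ℕ ℂ} (hA : IsRowDom ρ α A)
    (hK : IsCorner ρ C K) (hρ : 0 ≤ ρ) : IsCorner ρ (α * C) (imul A K) := by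
  intro i j
  rw [imul_apply]
  have hs := hA.summable_norm_mul_corner hK i j
  calc ‖∑' m, A i m * K m j‖ ≤ ∑' m, ‖A i m * K m j‖ := norm_tsum_le_tsum_norm hs
    _ ≤ ∑' m, C * ρ ^ j * (‖A i m‖ * ρ ^ m) := by
        refine hs.tsum_le_tsum (fun m => ?_) ((hA i).1.mul_left _)
        rw [norm_mul]
        calc ‖A i m‖ * ‖K m j‖ ≤ ‖A i m‖ * (C * ρ ^ (m + j)) :=
              mul_le_mul_of_nonneg_left (hK m j) (norm_nonneg _)
          _ = C * ρ ^ j * (‖A i m‖ * ρ ^ m) := by ring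
    _ = C * ρ ^ j * ∑' m, ‖A i m‖ * ρ ^ m := tsum_mul_left
    _ ≤ C * ρ ^ j * (α * ρ ^ i) :=
        mul_le_mul_of_nonneg_left (hA i).2 (mul_nonneg hK.nonneg (pow_nonneg hρ _))
    _ = α * C * ρ ^ (i + j) := by ring

/-- The truncated products `A P_N K` are corner kernels with the same constant, uniformly in `N`. [folklore] -/
theorem IsRowDom.imulTrunc_corner {ρ α C : ℝ} {A K : Matrix ℕ ℕ ℂ} (hA : IsRowDom ρ α A)
    (hK : IsCorner ρ C K) (hρ : 0 ≤ ρ) (N : ℕ) : IsCorner ρ (α * C) (imulTrunc N A K) := by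
  intro i j
  rw [imulTrunc_apply]
  have hs := hA.summable_norm_mul_corner hK i j
  calc ‖∑ m ∈ range N, A i m * K m j‖ ≤ ∑ m ∈ range N, ‖A i m * K m j‖ := norm_sum_le _ _
    _ ≤ ∑' m, ‖A i m * K m j‖ := hs.sum_le_tsum _ (fun m _ => norm_nonneg _)
    _ ≤ ∑' m, C * ρ ^ j * (‖A i m‖ * ρ ^ m) := by
        refine hs.tsum_le_tsum (fun m => ?_) ((hA i).1.mul_left _)
        rw [norm_mul]
        calc ‖A i m‖ * ‖K m j‖ ≤ ‖A i m‖ * (C * ρ ^ (m + j)) :=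
              mul_le_mul_of_nonneg_left (hK m j) (norm_nonneg _)
          _ = C * ρ ^ j * (‖A i m‖ * ρ ^ m) := by ring
    _ = C * ρ ^ j * ∑' m, ‖A i m‖ * ρ ^ m := tsum_mul_left
    _ ≤ C * ρ ^ j * (α * ρ ^ i) :=
        mul_le_mul_of_nonneg_left (hA i).2 (mul_nonneg hK.nonneg (pow_nonneg hρ _))
    _ = α * C * ρ ^ (i + j) := by ring

/-- A corner kernel times a column-dominated matrix: the defining series is absolutely summable. [folklore] -/
theorem IsCorner.summable_norm_mul_colDom {ρ α C : ℝ} {A K : Matrix ℕ ℕ ℂ} (hK : IsCorner ρ C K)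
    (hA : IsColDom ρ α A) (i j : ℕ) : Summable fun m => ‖K i m * A m j‖ := by
  refine Summable.of_nonneg_of_le (fun m => norm_nonneg _) (fun m => ?_)
    (((hA j).1.mul_left (C * ρ ^ i)))
  rw [norm_mul]
  calc ‖K i m‖ * ‖A m j‖ ≤ C * ρ ^ (i + m) * ‖A m j‖ :=
        mul_le_mul_of_nonneg_right (hK i m) (norm_nonneg _)
    _ = C * ρ ^ i * (ρ ^ m * ‖A m j‖) := by ring

/-- **A corner kernel times a column-dominated matrix is a corner kernel**, constant `C α`. [folklore] -/
theorem IsCorner.imul_colDom {ρ α C : ℝ} {A K : Matrix ℕ ℕ ℂ} (hK : IsCorner ρ C K)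
    (hA : IsColDom ρ α A) (hρ : 0 ≤ ρ) : IsCorner ρ (C * α) (Toeplitz.imul K A) := by
  intro i j
  rw [imul_apply]
  have hs := hK.summable_norm_mul_colDom hA i j
  calc ‖∑' m, K i m * A m j‖ ≤ ∑' m, ‖K i m * A m j‖ := norm_tsum_le_tsum_norm hs
    _ ≤ ∑' m, C * ρ ^ i * (ρ ^ m * ‖A m j‖) := by
        refine hs.tsum_le_tsum (fun m => ?_) ((hA j).1.mul_left _)
        rw [norm_mul]
        calc ‖K i m‖ * ‖A m j‖ ≤ C * ρ ^ (i + m) * ‖A m j‖ :=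
              mul_le_mul_of_nonneg_right (hK i m) (norm_nonneg _)
          _ = C * ρ ^ i * (ρ ^ m * ‖A m j‖) := by ring
    _ = C * ρ ^ i * ∑' m, ρ ^ m * ‖A m j‖ := tsum_mul_left
    _ ≤ C * ρ ^ i * (α * ρ ^ j) :=
        mul_le_mul_of_nonneg_left (hA j).2 (mul_nonneg hK.nonneg (pow_nonneg hρ _))
    _ = C * α * ρ ^ (i + j) := by ring

/-- The truncated products `K P_N A` are corner kernels with the same constant, uniformly in `N`. [folklore] -/
theorem IsCorner.imulTrunc_colDom {ρ α C : ℝ} {A K : Matrix ℕ ℕ ℂ} (hK : IsCorner ρ C K)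
    (hA : IsColDom ρ α A) (hρ : 0 ≤ ρ) (N : ℕ) : IsCorner ρ (C * α) (Toeplitz.imulTrunc N K A) := by
  intro i j
  rw [imulTrunc_apply]
  have hs := hK.summable_norm_mul_colDom hA i j
  calc ‖∑ m ∈ range N, K i m * A m j‖ ≤ ∑ m ∈ range N, ‖K i m * A m j‖ := norm_sum_le _ _
    _ ≤ ∑' m, ‖K i m * A m j‖ := hs.sum_le_tsum _ (fun m _ => norm_nonneg _)
    _ ≤ ∑' m, C * ρ ^ i * (ρ ^ m * ‖A m j‖) := by
        refine hs.tsum_le_tsum (fun m => ?_) ((hA j).1.mul_left _)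
        rw [norm_mul]
        calc ‖K i m‖ * ‖A m j‖ ≤ C * ρ ^ (i + m) * ‖A m j‖ :=
              mul_le_mul_of_nonneg_right (hK i m) (norm_nonneg _)
          _ = C * ρ ^ i * (ρ ^ m * ‖A m j‖) := by ring
    _ = C * ρ ^ i * ∑' m, ρ ^ m * ‖A m j‖ := tsum_mul_left
    _ ≤ C * ρ ^ i * (α * ρ ^ j) :=
        mul_le_mul_of_nonneg_left (hA j).2 (mul_nonneg hK.nonneg (pow_nonneg hρ _))
    _ = C * α * ρ ^ (i + j) := by ring

/-- **Corner kernels are row-dominated**, constant `C / (1 - ρ²)` (`0 ≤ ρ < 1`). [folklore] -/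
theorem IsCorner.isRowDom {ρ C : ℝ} {K : Matrix ℕ ℕ ℂ} (hK : IsCorner ρ C K) (hρ : 0 ≤ ρ)
    (hρ1 : ρ < 1) : IsRowDom ρ (C / (1 - ρ ^ 2)) K := by
  intro i
  have hρ2 : ρ ^ 2 < 1 := pow_lt_one₀ hρ hρ1 two_ne_zero
  have hgeo := summable_geometric_of_lt_one (pow_nonneg hρ 2) hρ2
  have hle : ∀ m, ‖K i m‖ * ρ ^ m ≤ C * ρ ^ i * (ρ ^ 2) ^ m := fun m =>
    calc ‖K i m‖ * ρ ^ m ≤ C * ρ ^ (i + m) * ρ ^ m :=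
          mul_le_mul_of_nonneg_right (hK i m) (pow_nonneg hρ _)
      _ = C * ρ ^ i * (ρ ^ 2) ^ m := by ring
  have hs : Summable fun m => ‖K i m‖ * ρ ^ m :=
    Summable.of_nonneg_of_le (fun m => mul_nonneg (norm_nonneg _) (pow_nonneg hρ _)) hle
      (hgeo.mul_left _)
  refine ⟨hs, ?_⟩
  calc ∑' m, ‖K i m‖ * ρ ^ m ≤ ∑' m, C * ρ ^ i * (ρ ^ 2) ^ m :=
        hs.tsum_le_tsum hle (hgeo.mul_left _)
    _ = C * ρ ^ i * (1 - ρ ^ 2)⁻¹ := by rw [tsum_mul_left, tsum_geometric_of_lt_one (pow_nonneg hρ 2) hρ2]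
    _ = C / (1 - ρ ^ 2) * ρ ^ i := by ring

/-- **Corner kernels are column-dominated**, constant `C / (1 - ρ²)` (`0 ≤ ρ < 1`). [folklore] -/
theorem IsCorner.isColDom {ρ C : ℝ} {K : Matrix ℕ ℕ ℂ} (hK : IsCorner ρ C K) (hρ : 0 ≤ ρ)
    (hρ1 : ρ < 1) : IsColDom ρ (C / (1 - ρ ^ 2)) K := by
  intro j
  have hρ2 : ρ ^ 2 < 1 := pow_lt_one₀ hρ hρ1 two_ne_zero
  have hgeo := summable_geometric_of_lt_one (pow_nonneg hρ 2) hρ2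
  have hle : ∀ m, ρ ^ m * ‖K m j‖ ≤ C * ρ ^ j * (ρ ^ 2) ^ m := fun m =>
    calc ρ ^ m * ‖K m j‖ ≤ ρ ^ m * (C * ρ ^ (m + j)) :=
          mul_le_mul_of_nonneg_left (hK m j) (pow_nonneg hρ _)
      _ = C * ρ ^ j * (ρ ^ 2) ^ m := by ring
  have hs : Summable fun m => ρ ^ m * ‖K m j‖ :=
    Summable.of_nonneg_of_le (fun m => mul_nonneg (pow_nonneg hρ _) (norm_nonneg _)) hle
      (hgeo.mul_left _)
  refine ⟨hs, ?_⟩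
  calc ∑' m, ρ ^ m * ‖K m j‖ ≤ ∑' m, C * ρ ^ j * (ρ ^ 2) ^ m :=
        hs.tsum_le_tsum hle (hgeo.mul_left _)
    _ = C * ρ ^ j * (1 - ρ ^ 2)⁻¹ := by rw [tsum_mul_left, tsum_geometric_of_lt_one (pow_nonneg hρ 2) hρ2]
    _ = C / (1 - ρ ^ 2) * ρ ^ j := by ring

/-- Sums of row-dominated matrices. [folklore] -/
theorem IsRowDom.add {ρ α β : ℝ} {A B : Matrix ℕ ℕ ℂ} (hA : IsRowDom ρ α A) (hB : IsRowDom ρ β B)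
    (hρ : 0 ≤ ρ) : IsRowDom ρ (α + β) (A + B) := by
  intro i
  have hle : ∀ m, ‖(A + B) i m‖ * ρ ^ m ≤ ‖A i m‖ * ρ ^ m + ‖B i m‖ * ρ ^ m := fun m => by
    rw [← add_mul]
    exact mul_le_mul_of_nonneg_right (norm_add_le _ _) (pow_nonneg hρ _)
  have hs : Summable fun m => ‖(A + B) i m‖ * ρ ^ m :=
    Summable.of_nonneg_of_le (fun m => mul_nonneg (norm_nonneg _) (pow_nonneg hρ _)) hle
      ((hA i).1.add (hB i).1)
  refine ⟨hs, ?_⟩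
  calc ∑' m, ‖(A + B) i m‖ * ρ ^ m ≤ ∑' m, (‖A i m‖ * ρ ^ m + ‖B i m‖ * ρ ^ m) :=
        hs.tsum_le_tsum hle ((hA i).1.add (hB i).1)
    _ = (∑' m, ‖A i m‖ * ρ ^ m) + ∑' m, ‖B i m‖ * ρ ^ m := (hA i).1.tsum_add (hB i).1
    _ ≤ α * ρ ^ i + β * ρ ^ i := add_le_add (hA i).2 (hB i).2
    _ = (α + β) * ρ ^ i := by ring

/-- Sums of column-dominated matrices. [folklore] -/
theorem IsColDom.add {ρ α β : ℝ} {A B : Matrix ℕ ℕ ℂ} (hA : IsColDom ρ α A) (hB : IsColDom ρ β B)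
    (hρ : 0 ≤ ρ) : IsColDom ρ (α + β) (A + B) := by
  intro j
  have hle : ∀ m, ρ ^ m * ‖(A + B) m j‖ ≤ ρ ^ m * ‖A m j‖ + ρ ^ m * ‖B m j‖ := fun m => by
    rw [← mul_add]
    exact mul_le_mul_of_nonneg_left (norm_add_le _ _) (pow_nonneg hρ _)
  have hs : Summable fun m => ρ ^ m * ‖(A + B) m j‖ :=
    Summable.of_nonneg_of_le (fun m => mul_nonneg (pow_nonneg hρ _) (norm_nonneg _)) hle
      ((hA j).1.add (hB j).1)
  refine ⟨hs, ?_⟩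
  calc ∑' m, ρ ^ m * ‖(A + B) m j‖ ≤ ∑' m, (ρ ^ m * ‖A m j‖ + ρ ^ m * ‖B m j‖) :=
        hs.tsum_le_tsum hle ((hA j).1.add (hB j).1)
    _ = (∑' m, ρ ^ m * ‖A m j‖) + ∑' m, ρ ^ m * ‖B m j‖ := (hA j).1.tsum_add (hB j).1
    _ ≤ α * ρ ^ j + β * ρ ^ j := add_le_add (hA j).2 (hB j).2
    _ = (α + β) * ρ ^ j := by ring

/-- The identity matrix is row-dominated with constant `1`. [folklore] -/
theorem isRowDom_one (ρ : ℝ) : IsRowDom ρ 1 (1 : Matrix ℕ ℕ ℂ) := by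
  intro i
  have heq : (fun m => ‖(1 : Matrix ℕ ℕ ℂ) i m‖ * ρ ^ m) = fun m => if m = i then ρ ^ i else 0 := by
    funext m
    by_cases h : m = i
    · subst h; simp
    · simp [Ne.symm h, h]
  rw [heq]
  refine ⟨summable_of_ne_finset_zero (s := {i}) (by intro m hm; simp at hm; simp [hm]), ?_⟩
  rw [tsum_ite_eq]; simp

/-- The identity matrix is column-dominated with constant `1`. [folklore] -/
theorem isColDom_one (ρ : ℝ) : IsColDom ρ 1 (1 : Matrix ℕ ℕ ℂ) := by
  intro j
  have heq : (fun m => ρ ^ m * ‖(1 : Matrix ℕ ℕ ℂ) m j‖) = fun m => if m = j then ρ ^ j else 0 := by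
    funext m
    by_cases h : m = j
    · subst h; simp
    · simp [h]
  rw [heq]
  refine ⟨summable_of_ne_finset_zero (s := {j}) (by intro m hm; simp at hm; simp [hm]), ?_⟩
  rw [tsum_ite_eq]; simp

end Literature.Analysis.Toeplitz
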